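import Mathlib
import Literature.NumberTheory.Automorphic.HilbertModularFormQExpansion
import Summits.Langlands.Langlands.Theorems.CapacityClassicalityHilbertIntegralOverconvergentIsCongruenceKoecherGlue
import Summits.Langlands.Langlands.Theorems.CapacityClassicalityHilbertIntegralOverconvergentIsCongruenceStubTotallyRealEmbeddings

/-!
# Radius-type coefficient bounds from convergence on the whole tube (stub R3)

Stub R3 `stub_coeff_radius_from_tube` of line Sketch-ideate-r1-k1 (section R, RESHAPE 14) for the crux
`HilbertIntegralOverconvergentIsCongruence` (stmt-Langlands-8485): if `∑_{ν ∈ 𝔡⁻¹} |c_ν| e^{-2π⟨ν,y⟩} < ∞` at every height `y ≫ 0`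
(the crux's hypothesis "the `q`-series converges on the whole tube"), then for every `0 < s < 1` the quantities `|c_ν| s^{w(ν)}`,
`w(ν) = Tr(αν)`, `ν` in the cone `qIndexSet F`, are bounded — the radius-type input of the landed S17 `stub_summable_of_levelGrowth`,
which turns them into the engine's archimedean hypothesis `harch`.  Proof: on the cone `Tr(αν) ≥ (min_σ σα)·Tr ν`
(`∑_σ σ = Tr` for the totally real field), so with `t` defined by `e^{-2πt·Tr ν} = s^{(min σα) Tr ν}` one has
`s^{Tr(αν)} ≤ e^{-2π⟨ν, t𝟙⟩}`, and a term of the convergent height-`t𝟙` series is at most its sum.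
-/

set_option linter.dupNamespace false

noncomputable section

namespace Summit.Langlands.Langlands.Theorems.HilbertIntegralOverconvergentIsCongruence

open MeasureTheory Complex NumberField
open Literature.NumberTheory.Automorphic Literature.NumberTheory.Automorphic.HilbertModular

/-- **Stub R3 — `stub_coeff_radius_from_tube`.** From convergence on the whole tube to radius-type bounds: if
`∑_{ν ∈ 𝔡⁻¹} |c_ν| e^{-2π⟨ν,y⟩} < ∞` at every height `y ≫ 0`, then for every `0 < s < 1` the quantities `|c_ν| s^{Tr(αν)}`, `ν` in
the cone, are bounded. [folklore] -/
theorem stub_coeff_radius_from_tube (F : Type) [Field F] [NumberField F] [NumberField.IsTotallyReal F] (α : F)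
    (hα : ∀ σ : F →+* ℝ, 0 < σ α) (c : F → ℂ)
    (habs : ∀ y : (F →+* ℝ) → ℝ, (∀ σ, 0 < y σ) →
      Summable (fun ν : {ν : F | ∀ b : 𝓞 F, ∃ n : ℤ, Algebra.trace ℚ F (ν * b) = n} ↦
        ‖c ν‖ * Real.exp (-(2 * Real.pi * ∑ σ : F →+* ℝ, σ (ν : F) * y σ))))
    (w : F → ℕ) (hw : ∀ ν ∈ qIndexSet F, (w ν : ℝ) = ((Algebra.trace ℚ F (α * ν) : ℚ) : ℝ))
    (s : ℝ) (hs0 : 0 < s) (hs1 : s < 1) :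
    ∃ C : ℝ, ∀ ν ∈ qIndexSet F, ‖c ν‖ * s ^ w ν ≤ C := by
  obtain ⟨htr, -⟩ := stub_totallyReal_embeddings F
  obtain ⟨m, hm, hmα⟩ := koe_exists_pos_le (fun σ : F →+* ℝ ↦ σ α) hα
  set L : ℝ := Real.log s with hLdef
  have hL : L < 0 := Real.log_neg hs0 hs1
  set t : ℝ := -(m * L) / (2 * Real.pi) with htdef
  have ht : 0 < t := by
    rw [htdef]
    exact div_pos (by nlinarith) (by positivity)
  set y : (F →+* ℝ) → ℝ := fun _ ↦ t with hydef
  have hy : ∀ σ, 0 < y σ := fun _ ↦ ht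
  have hsum := habs y hy
  refine ⟨∑' ν : {ν : F | ∀ b : 𝓞 F, ∃ n : ℤ, Algebra.trace ℚ F (ν * b) = n},
    ‖c ν‖ * Real.exp (-(2 * Real.pi * ∑ σ : F →+* ℝ, σ (ν : F) * y σ)), fun ν hν ↦ ?_⟩
  -- the trace of `ν` through the real embeddings, and `Tr(αν) ≥ m · Tr ν` on the cone
  have hνnonneg : ∀ σ : F →+* ℝ, 0 ≤ σ ν := by
    rcases hν.2 with h0 | hpos
    · intro σ; simp [h0]
    · exact fun σ ↦ (hpos σ).le
  have htrace : ((Algebra.trace ℚ F (α * ν) : ℚ) : ℝ) = ∑ σ : F →+* ℝ, σ α * σ ν := by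
    have h := htr (α * ν)
    simp only [map_mul] at h
    rw [h, eq_ratCast]
  have hcomp : m * ∑ σ : F →+* ℝ, σ ν ≤ (w ν : ℝ) := by
    rw [hw ν hν, htrace, Finset.mul_sum]
    exact Finset.sum_le_sum fun σ _ ↦ mul_le_mul_of_nonneg_right (hmα σ) (hνnonneg σ)
  -- `s^{w ν} ≤ e^{-2π t Tr ν}`
  have hpow : s ^ w ν = Real.exp ((w ν : ℝ) * L) := by
    rw [hLdef, Real.exp_nat_mul, Real.exp_log hs0]
  have hexp : s ^ w ν ≤ Real.exp (-(2 * Real.pi * ∑ σ : F →+* ℝ, σ ν * y σ)) := by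
    rw [hpow]
    apply Real.exp_le_exp.2
    have h1 : (w ν : ℝ) * L ≤ (m * ∑ σ : F →+* ℝ, σ ν) * L := mul_le_mul_of_nonpos_right hcomp hL.le
    have h2 : (m * ∑ σ : F →+* ℝ, σ ν) * L = -(2 * Real.pi * ∑ σ : F →+* ℝ, σ ν * y σ) := by
      simp only [hydef, htdef, ← Finset.sum_mul]
      field_simp
    linarith
  -- the term is at most the sum
  have hterm : ‖c ν‖ * Real.exp (-(2 * Real.pi * ∑ σ : F →+* ℝ, σ ν * y σ)) ≤
      ∑' μ : {ν : F | ∀ b : 𝓞 F, ∃ n : ℤ, Algebra.trace ℚ F (ν * b) = n},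
        ‖c μ‖ * Real.exp (-(2 * Real.pi * ∑ σ : F →+* ℝ, σ (μ : F) * y σ)) :=
    hsum.le_tsum ⟨ν, hν.1⟩ fun μ _ ↦ mul_nonneg (norm_nonneg _) (Real.exp_nonneg _)
  calc ‖c ν‖ * s ^ w ν ≤ ‖c ν‖ * Real.exp (-(2 * Real.pi * ∑ σ : F →+* ℝ, σ ν * y σ)) :=
        mul_le_mul_of_nonneg_left hexp (norm_nonneg _)
    _ ≤ _ := hterm

end Summit.Langlands.Langlands.Theorems.HilbertIntegralOverconvergentIsCongruence
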